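import Summits.Ventures.PercRepro.C026ProdCFEveryP
import Summits.Ventures.PercRepro.C026ProdCFComponents

/-!
# THEOREM PROD-CF, Corollary 4: the one-component reduction of C-026 at every `p` (p5, gen 16)

mine-3's Corollary 4 (`proofs/MINE3-PRODUCT.md` §2b): C-026 for every marked multigraph at every
edge weight follows from (CF) at `p = ½` on every ONE-COMPONENT core — a marked multigraph whose
edge-carrying non-marks form one component of `G − {a, b, c}`.

* `OneComponent H a b c` — every two edge-carrying non-marks of `H` are joined through non-marks;
* `oneComponent_colPart` — the component cores `H_Γ` of the component colouring are one-component;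
* **`slackCF_nonneg_of_oneComponent`** — (iii) ⟹ (ii): (CF) at `p = ½` on every one-component
  marked multigraph gives (CF) at `p = ½` on every marked multigraph (`slackCF_nonneg_of_components`);
* **`c026_of_slackCF_all`** — (ii) ⟹ (i): (CF) at `p = ½` on every marked multigraph gives C-026 at
  every `p` on every marked multigraph (`c026_of_slackCF_minors`);
* **`c026_of_oneComponent_all`** — (iii) ⟹ (i), the two composed: **the every-`p` conjecture C-026
  for all marked multigraphs is its `p = ½` one-component case.**

(The vertex and edge types of the one-component graphs range over the universes of `V` and `E`:
the marked minors of `G` live on `Quotient (G.connSetoid v)` and `Face u v`, the component cores on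
`V` and a subtype of `E`.)
-/

universe u v

namespace PercRepro

open Finset

namespace MultiGraph

section Corollary4

variable {V : Type u} {E : Type v}

/-- **A one-component marked multigraph**: any two non-marks carrying an edge are joined by a walk
through non-marks (`G − {a, b, c}` has at most one component with edges; mark–mark edges and loops
at marks are allowed). -/
def OneComponent (H : MultiGraph V E) (a b c : V) : Prop :=
  ∀ x y, x ∉ ({a, b, c} : Set V) → y ∉ ({a, b, c} : Set V) → (∃ e, H.EdgeAt e x) →
    (∃ e, H.EdgeAt e y) → H.OffMarks a b c x y

/-- An edge of `G` coloured by the component `κ` at a non-mark `u` puts `u` in `κ`. -/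
theorem quotient_eq_of_compColour {G : MultiGraph V E} {a b c u : V}
    (hu : u ∉ ({a, b, c} : Set V)) {e : E} (he : G.EdgeAt e u)
    {κ : Quotient (G.offMarksSetoid a b c)} (hκ : G.compColour a b c e = Sum.inl κ) :
    (⟦u⟧ : Quotient (G.offMarksSetoid a b c)) = κ := by
  rw [compColour_of_edgeAt hu he] at hκ
  exact Sum.inl.inj hκ

/-- A walk of `G` through non-marks starting in the component `κ` uses edges of colour `κ` only,
hence is a walk of the core `colClassGraph _ (Sum.inl κ)`. -/
theorem offMarks_colPart_of_offMarks {G : MultiGraph V E} {a b c : V}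
    {κ : Quotient (G.offMarksSetoid a b c)} {x u : V}
    (hxκ : (⟦x⟧ : Quotient (G.offMarksSetoid a b c)) = κ) (h : G.OffMarks a b c x u) :
    (G.colClassGraph (G.compColour a b c) (Sum.inl κ)).OffMarks a b c x u := by
  unfold OffMarks at h ⊢
  unfold ConnAvoid at h ⊢
  induction h with
  | refl => exact Relation.ReflTransGen.refl
  | @tail u w hxu huw ih =>
    obtain ⟨⟨e, _, hend⟩, huM, hwM⟩ := huw
    have hj : G.Joins e u w := hend
    have hu : (⟦u⟧ : Quotient (G.offMarksSetoid a b c)) = κ :=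
      (Quotient.sound (hxu : G.OffMarks a b c x u)).symm.trans hxκ
    have hcol : G.compColour a b c e = Sum.inl κ := by
      rw [compColour_of_edgeAt huM (EdgeAt.of_joins_left hj), hu]
    exact ih.tail ⟨⟨⟨e, hcol⟩, rfl, hend⟩, huM, hwM⟩

/-- **The component cores are one-component**: in the colour class `Sum.inl κ` of the component
colouring, any two edge-carrying non-marks lie in `κ`, and a walk of `G` through non-marks between
them is a walk of the core. -/
theorem oneComponent_colPart (G : MultiGraph V E) (a b c : V)
    (κ : Quotient (G.offMarksSetoid a b c)) :
    (G.colClassGraph (G.compColour a b c) (Sum.inl κ)).OneComponent a b c := by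
  intro x y hx hy ⟨ex, hex⟩ ⟨ey, hey⟩
  have hxκ : (⟦x⟧ : Quotient (G.offMarksSetoid a b c)) = κ :=
    quotient_eq_of_compColour (G := G) hx (e := ex.1) hex ex.2
  have hyκ : (⟦y⟧ : Quotient (G.offMarksSetoid a b c)) = κ :=
    quotient_eq_of_compColour (G := G) hy (e := ey.1) hey ey.2
  exact offMarks_colPart_of_offMarks hxκ (Quotient.exact (hxκ.trans hyκ.symm))

/-- **Corollary 4, (iii) ⟹ (ii)**: (CF) at `p = ½` on every one-component marked multigraph gives
(CF) at `p = ½` on every marked multigraph. -/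
theorem slackCF_nonneg_of_oneComponent
    (hiii : ∀ (V' : Type u) (E' : Type v) [Fintype E'] (H : MultiGraph V' E') (a b c : V'),
      H.OneComponent a b c → 0 ≤ H.slackCF a b c)
    [Fintype E] (G : MultiGraph V E) (a b c : V) : 0 ≤ G.slackCF a b c := by
  classical
  exact slackCF_nonneg_of_components a b c fun κ _ =>
    hiii V _ (G.colClassGraph (G.compColour a b c) (Sum.inl κ)) a b c (oneComponent_colPart G a b c κ)

/-- **Corollary 4, (ii) ⟹ (i)**: (CF) at `p = ½` on every marked multigraph gives C-026 at every
edge weight `p` on every marked multigraph (the antipodal principle on the marked minors). -/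
theorem c026_of_slackCF_all
    (hii : ∀ (V' : Type u) (E' : Type v) [Fintype E'] (H : MultiGraph V' E') (a b c : V'),
      0 ≤ H.slackCF a b c)
    [Fintype E] [DecidableEq E] (G : MultiGraph V E) (a b c : V) (p : E → ℝ) (hp : IsProb p) :
    (G.law3 p a b c 0 + G.law3 p a b c 1) * (G.law3 p a b c 1 + G.law3 p a b c 4) ≤
      G.law3 p a b c 1 + G.law3 p a b c 2 + G.law3 p a b c 3 :=
  c026_of_slackCF_minors G a b c (fun u v _ => hii _ _ (G.minor u v) _ _ _) p hp

/-- **COROLLARY 4 (mine-3, PROD-CF): the every-`p` C-026 conjecture for all marked multigraphs is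
its `p = ½` one-component case** — (CF) at `p = ½` on every one-component marked multigraph gives
C-026 at every edge weight on every marked multigraph. -/
theorem c026_of_oneComponent_all
    (hiii : ∀ (V' : Type u) (E' : Type v) [Fintype E'] (H : MultiGraph V' E') (a b c : V'),
      H.OneComponent a b c → 0 ≤ H.slackCF a b c)
    [Fintype E] [DecidableEq E] (G : MultiGraph V E) (a b c : V) (p : E → ℝ) (hp : IsProb p) :
    (G.law3 p a b c 0 + G.law3 p a b c 1) * (G.law3 p a b c 1 + G.law3 p a b c 4) ≤
      G.law3 p a b c 1 + G.law3 p a b c 2 + G.law3 p a b c 3 :=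
  c026_of_slackCF_all (fun _ _ _ H a b c => slackCF_nonneg_of_oneComponent hiii H a b c)
    G a b c p hp

end Corollary4

end MultiGraph

end PercRepro
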